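import Mathlib
import HarnessLib
import Summits.Ventures.LatticeQCDFlow.Scaling.AcceptanceGiniFloorSharp

/-!
# LatticeQCDFlow / Scaling — `acc ≥ (8/9)·ESS`: the SHARP linear ESS floor of the equilibrium
# acceptance of an independence sampler (the tree had `acc ≥ ESS/2`)

HONEST FRAMING: exact (Metropolis-corrected) sampling algorithms for lattice gauge theory;
figures of merit are autocorrelation/cost numbers at stated couplings and volumes; no
continuum-physics claim.

Venture `LatticeQCDFlow` (cell pub-lqcd), topic `Scaling`; FANOUT row 3 (`s0-u1-a`, S0-B
implementation A, GEN-8).  NEW WORK of the cell, not a published result; NO definition is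
introduced.  In the language of inequality indices the statement is `(1 − G)(1 + c²) ≥ 8/9` for the
Gini index `G` and coefficient of variation `c` of a non-negative law; the printed neighbours are
Glasser's `√3·G ≤ c` (1961; Arnold, *Pareto Distributions* (2015) eq. (4.2.117) — the ingredient of
case (i) below, in the tree as row 3's `sq_qq_abs_weight_le_sharp`) and Taguchi's `P ≤ G ≤ P(2 − P)`
(ibid. (4.2.116)); no printed lower bound for `(1 − G)(1 + c²)` was found (presearch: corpus
keyword + vector + galaxy, 2026-08-22).  Sequel of row 3's `Scaling/AcceptanceGiniFloor` (`acc ≥ ESS/2`, twin of row 2's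
measure-theoretic `meanAccept_ge_half_ESS`) and `Scaling/AcceptanceGiniFloorSharp` (imported: the
mid-rank `g_x = Σ_y q_y sign(w_x − w_y)`, `Σ q g = 0`, `Σ q g² ≤ 1/3`, and
`(E|w − w′|)² ≤ (4/3)·Var_q w`).

## Setting (finite `X`; target `p ≥ 0`, model `q > 0`, both normalised; `w = p/q`, `E_q w = 1`;
## `acc = acc(p,q) = E_{q⊗q} min(w, w′) = 1 − Γ` with `Γ = ½E|w − w′|` (Gini half mean
## difference); `1/ESS = E_q w²`)

* `hinge_sq_step` — one-interval Hermite–Hadamard for `u ↦ ((u − v)₊)²`: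
  `(a − v)₊³/3 + ℓ·((a + ℓ/2 − v)₊)² ≤ (a + ℓ − v)₊³/3` (`a, ℓ, v ≥ 0`);
* **`sum_midrank_hinge_sq_le`** — for every finset `s`, masses `q ≥ 0` and level `v ≥ 0`:
  `Σ_{x∈s} q_x ((m_s(x) − v)₊)² ≤ (Q_s − v)₊³/3`, `m_s(x) = Σ_{y∈s} q_y (sign(w_x − w_y) + 1)/2` the
  mid-rank inside `s`, `Q_s = Σ_s q` (induction removing the top weight class: the mid-rank of the
  class is the midpoint of its interval, and the convex `((· − v)₊)²` at a midpoint is below its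
  interval average) — the rank-space Cauchy–Schwarz denominator `∫_v^1 (u − v)² du = (1 − v)³/3`;
* `sum_mul_weight_midrank01` — `Σ_x q_x w_x m(x) = (1 + Γ)/2` with `m = (g + 1)/2 ∈ [0, 1]`;
* **`accRate_mul_inv_essFrac_ge`** — `acc · (1/ESS) ≥ 8/9`, by two cases:
  (i) `acc ≥ 2/3` (`Γ ≤ 1/3`): the imported Gini bound gives `1/ESS ≥ 1 + 3Γ²`, and
  `(1 − Γ)(1 + 3Γ²) = 8/9 + (1 − 3Γ)³/9`;
  (ii) `acc < 2/3`: Cauchy–Schwarz against the rank hinge `h = (m − v)₊` at `v = (3Γ − 1)/2`: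
  `acc = Σ q w (m − v) ≤ Σ q w h ≤ √(E_q w²)·√(Σ q h²) ≤ √(1/ESS)·√((1 − v)³/3)` with
  `1 − v = (3/2)·acc`, i.e. `acc² ≤ (9/8)·acc³/ESS`;
* **`eight_ninths_essFrac_le_accRate`** — `(8/9)·ESS ≤ acc` for every normalised pair (`p ≥ 0`,
  `q > 0`): population `ESS/N = 0.9` forces `acc ≥ 0.8`, `0.5` forces `acc ≥ 0.444` (the `/2` floor:
  `0.45`, `0.25`); together with the imported `acc ≥ 1 − √((1/ESS − 1)/3)` (better above
  `ESS ≈ 0.703`).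

Why `8/9` is the right constant (remark, not typed): for `m` equally likely, equally spaced weights
`acc·(1/ESS) = 2(2m + 1)²/(9m(m + 1)) ↓ 8/9` (`m = 1, 2, 3`: `1`, `25/27`, `49/54`), and mixing in an
atom of zero target weight leaves `acc·(1/ESS)/(E w)³` unchanged; the infimum `8/9` is the uniform
law on `[0, c]` (`acc = 2c/3·…`: `E min = c/3`, `E w² = c²/3`, `E w = c/2`).  NOT CLAIMED: attainment
on a finite space; any acceptance or ESS of ours; nothing re-scored.
-/

namespace Summit.Ventures.LatticeQCDFlow.Theory2

open Finset
open Literature.Probability.MarkovChains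
open Summit.Ventures.LatticeQCDFlow.Exactness

variable {X : Type*} [Fintype X]

/-! ### Hermite–Hadamard for the squared hinge at mid-ranks -/

/-- **One interval.**  For `a, ℓ, v ≥ 0`:
`(a − v)₊³/3 + ℓ·((a + ℓ/2 − v)₊)² ≤ (a + ℓ − v)₊³/3` — the value of the convex `((· − v)₊)²` at the
midpoint of `[a, a + ℓ]`, times the length, is at most its integral over the interval. [folklore] -/
theorem hinge_sq_step {a ℓ v : ℝ} (ha : 0 ≤ a) (hℓ : 0 ≤ ℓ) (hv : 0 ≤ v) :
    (max (a - v) 0) ^ 3 / 3 + ℓ * (max (a + ℓ / 2 - v) 0) ^ 2 ≤ (max (a + ℓ - v) 0) ^ 3 / 3 := by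
  have _ := ha
  have _ := hv
  rcases le_or_gt v a with h1 | h1
  · -- `v ≤ a`: no truncation anywhere; the slack is `ℓ³/12`
    rw [max_eq_left (by linarith), max_eq_left (by linarith), max_eq_left (by linarith)]
    nlinarith [pow_nonneg hℓ 3]
  rcases le_or_gt v (a + ℓ / 2) with h2 | h2
  · -- `a < v ≤ a + ℓ/2`
    rw [max_eq_right (by linarith), max_eq_left (by linarith), max_eq_left (by linarith)]
    -- with `e = a + ℓ/2 − v ∈ [0, ℓ/2]`: `(ℓ/2 + e)³/3 − ℓ e² = ℓ³/24 + (ℓe/4)(ℓ − 2e) + e³/3 ≥ 0`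
    have he0 : 0 ≤ a + ℓ / 2 - v := by linarith
    have he1 : a + ℓ / 2 - v ≤ ℓ / 2 := by linarith
    nlinarith [mul_nonneg (mul_nonneg hℓ he0) (by linarith : (0:ℝ) ≤ ℓ - 2 * (a + ℓ / 2 - v)),
      pow_nonneg he0 3, pow_nonneg hℓ 3]
  · -- `v > a + ℓ/2`: the left side vanishes
    rw [max_eq_right (by linarith), max_eq_right (by linarith)]
    have h0 : 0 ≤ max (a + ℓ - v) 0 := le_max_right _ _
    have e : (0 : ℝ) ^ 3 / 3 + ℓ * 0 ^ 2 = 0 := by ring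
    rw [e]
    positivity

omit [Fintype X] in
/-- **Mid-ranks tile the unit interval (Hermite–Hadamard for the squared hinge).**  For masses
`q ≥ 0`, values `w`, a finset `s` and a level `v ≥ 0`:
`Σ_{x∈s} q_x ((m_s(x) − v)₊)² ≤ (Q_s − v)₊³/3`, where
`m_s(x) = Σ_{y∈s} q_y (sign(w_x − w_y) + 1)/2 = q_s(w < w_x) + q_s(w = w_x)/2` is the mid-rank of
`x` inside `s` and `Q_s = Σ_{y∈s} q_y`: the weight classes occupy consecutive intervals of lengths
their masses, each mid-rank is the midpoint of its class interval, and `hinge_sq_step` adds the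
classes from the top. [folklore] -/
theorem sum_midrank_hinge_sq_le (q w : X → ℝ) (hq : ∀ x, 0 ≤ q x) {v : ℝ} (hv : 0 ≤ v)
    (s : Finset X) :
    ∑ x ∈ s, q x * (max ((∑ y ∈ s, q y * ((Real.sign (w x - w y) + 1) / 2)) - v) 0) ^ 2
      ≤ (max ((∑ y ∈ s, q y) - v) 0) ^ 3 / 3 := by
  classical
  induction s using Finset.strongInduction with
  | H s ih =>
    rcases s.eq_empty_or_nonempty with rfl | hne
    · simp only [sum_empty, zero_sub]
      positivity
    obtain ⟨x₀, hx₀, hmax⟩ := exists_max_image s w hne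
    set M := w x₀ with hM
    -- the lower part `s'` (weights `< M`) and the top class (weights `= M`)
    set s' : Finset X := s.filter (fun x => w x < M) with hs'
    have hs'sub : s' ⊂ s := filter_ssubset.mpr ⟨x₀, hx₀, lt_irrefl _⟩
    have htop : ∀ x ∈ s, ¬ (w x < M) → w x = M := fun x hx h => le_antisymm (hmax x hx) (not_lt.mp h)
    set Q' := ∑ y ∈ s', q y with hQ'
    set ℓ := ∑ y ∈ s.filter (fun x => ¬ (w x < M)), q y with hℓ
    have hQ'0 : 0 ≤ Q' := sum_nonneg fun y _ => hq y
    have hℓ0 : 0 ≤ ℓ := sum_nonneg fun y _ => hq y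
    have hQs : ∑ y ∈ s, q y = Q' + ℓ := (sum_filter_add_sum_filter_not s (fun x => w x < M) q).symm
    -- mid-ranks: unchanged on `s'`, equal to `Q' + ℓ/2` on the top class
    have hmid_low : ∀ x ∈ s, w x < M →
        ∑ y ∈ s, q y * ((Real.sign (w x - w y) + 1) / 2)
          = ∑ y ∈ s', q y * ((Real.sign (w x - w y) + 1) / 2) := by
      intro x _ hxM
      rw [← sum_filter_add_sum_filter_not s (fun x => w x < M)]
      have h0 : ∑ y ∈ s.filter (fun x => ¬ (w x < M)), q y * ((Real.sign (w x - w y) + 1) / 2) = 0 := by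
        refine sum_eq_zero fun y hy => ?_
        obtain ⟨hys, hyM⟩ := mem_filter.mp hy
        have hwy : w y = M := htop y hys hyM
        rw [hwy, Real.sign_of_neg (by linarith)]
        ring
      rw [h0, add_zero]
    have hmid_top : ∀ x ∈ s, ¬ (w x < M) →
        ∑ y ∈ s, q y * ((Real.sign (w x - w y) + 1) / 2) = Q' + ℓ / 2 := by
      intro x hx hxM
      have hwx : w x = M := htop x hx hxM
      rw [← sum_filter_add_sum_filter_not s (fun x => w x < M)]
      have h1 : ∑ y ∈ s', q y * ((Real.sign (w x - w y) + 1) / 2) = Q' := by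
        refine sum_congr rfl fun y hy => ?_
        obtain ⟨-, hyM⟩ := mem_filter.mp hy
        rw [hwx, Real.sign_of_pos (by linarith)]
        ring
      have h2 : ∑ y ∈ s.filter (fun x => ¬ (w x < M)), q y * ((Real.sign (w x - w y) + 1) / 2)
          = ℓ / 2 := by
        have e : ∀ y ∈ s.filter (fun x => ¬ (w x < M)),
            q y * ((Real.sign (w x - w y) + 1) / 2) = q y / 2 := by
          intro y hy
          obtain ⟨hys, hyM⟩ := mem_filter.mp hy
          rw [hwx, htop y hys hyM, sub_self, Real.sign_zero]
          ring
        rw [sum_congr rfl e, ← sum_div]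
      rw [h1, h2]
    -- split the sum and use the induction hypothesis on `s'`
    rw [← sum_filter_add_sum_filter_not s (fun x => w x < M)]
    have hlow : ∑ x ∈ s', q x * (max ((∑ y ∈ s, q y * ((Real.sign (w x - w y) + 1) / 2)) - v) 0) ^ 2
        = ∑ x ∈ s', q x * (max ((∑ y ∈ s', q y * ((Real.sign (w x - w y) + 1) / 2)) - v) 0) ^ 2 := by
      refine sum_congr rfl fun x hx => ?_
      obtain ⟨hxs, hxM⟩ := mem_filter.mp hx
      rw [hmid_low x hxs hxM]
    have htopsum : ∑ x ∈ s.filter (fun x => ¬ (w x < M)),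
        q x * (max ((∑ y ∈ s, q y * ((Real.sign (w x - w y) + 1) / 2)) - v) 0) ^ 2
        = ℓ * (max (Q' + ℓ / 2 - v) 0) ^ 2 := by
      have e : ∀ x ∈ s.filter (fun x => ¬ (w x < M)),
          q x * (max ((∑ y ∈ s, q y * ((Real.sign (w x - w y) + 1) / 2)) - v) 0) ^ 2
          = q x * (max (Q' + ℓ / 2 - v) 0) ^ 2 := by
        intro x hx
        obtain ⟨hxs, hxM⟩ := mem_filter.mp hx
        rw [hmid_top x hxs hxM]
      rw [sum_congr rfl e, ← sum_mul]
    rw [hlow, htopsum, hQs]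
    have hIH := ih s' hs'sub
    calc _ ≤ (max (Q' - v) 0) ^ 3 / 3 + ℓ * (max (Q' + ℓ / 2 - v) 0) ^ 2 := by linarith
      _ ≤ (max (Q' + ℓ - v) 0) ^ 3 / 3 := hinge_sq_step hQ'0 hℓ0 hv

/-! ### `acc · (1/ESS) ≥ 8/9` -/

/-- `Σ_x q_x w_x m(x) = (1 + Γ)/2` for the `[0,1]`-valued mid-rank `m = (g + 1)/2`, where
`Γ = Σ_x q_x w_x g_x = ½·E_{q⊗q}|w − w′|` (`E_q w = 1`, `Σ q = 1`). [folklore] -/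
theorem sum_mul_weight_midrank01 {p q : X → ℝ} (hq : ∀ x, 0 < q x) (hp1 : ∑ x, p x = 1)
    (hq1 : ∑ x, q x = 1) :
    ∑ x, q x * weight p q x * (∑ y, q y * ((Real.sign (weight p q x - weight p q y) + 1) / 2))
      = (1 + ∑ x, q x * weight p q x * ∑ y, q y * Real.sign (weight p q x - weight p q y)) / 2 := by
  have e : ∀ x, ∑ y, q y * ((Real.sign (weight p q x - weight p q y) + 1) / 2)
      = ((∑ y, q y * Real.sign (weight p q x - weight p q y)) + 1) / 2 := by
    intro x
    have h : ∀ y, q y * ((Real.sign (weight p q x - weight p q y) + 1) / 2)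
        = (1 / 2) * (q y * Real.sign (weight p q x - weight p q y)) + (1 / 2) * q y := fun y => by ring
    simp_rw [h]
    rw [sum_add_distrib, ← mul_sum, ← mul_sum, hq1]
    ring
  simp_rw [e]
  have e2 : ∀ x, q x * weight p q x * (((∑ y, q y * Real.sign (weight p q x - weight p q y)) + 1) / 2)
      = (1 / 2) * (q x * weight p q x * ∑ y, q y * Real.sign (weight p q x - weight p q y))
        + (1 / 2) * (q x * weight p q x) := fun x => by ring
  simp_rw [e2]
  rw [sum_add_distrib, ← mul_sum, ← mul_sum, sum_mul_weight hq hp1]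
  ring

/-- The equilibrium acceptance of a normalised pair (`p ≥ 0`, `q > 0`) is positive: the diagonal
term `p_x q_x` of a point carrying target mass already contributes. [folklore] -/
theorem accRate_pos_of_normalised {p q : X → ℝ} (hp : ∀ x, 0 ≤ p x) (hq : ∀ x, 0 < q x)
    (hp1 : ∑ x, p x = 1) : 0 < accRate p q := by
  classical
  obtain ⟨x₀, -, hx₀⟩ := exists_lt_of_sum_lt (s := univ) (f := fun _ => (0:ℝ)) (g := p)
    (by rw [sum_const_zero, hp1]; exact one_pos)
  have hterm : ∀ x y, 0 ≤ min (p x * q y) (p y * q x) := fun x y =>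
    le_min (mul_nonneg (hp x) (hq y).le) (mul_nonneg (hp y) (hq x).le)
  unfold accRate
  calc (0 : ℝ) < min (p x₀ * q x₀) (p x₀ * q x₀) := by
        rw [min_self]; exact mul_pos hx₀ (hq x₀)
    _ ≤ ∑ y, min (p x₀ * q y) (p y * q x₀) :=
        single_le_sum (f := fun y => min (p x₀ * q y) (p y * q x₀)) (fun y _ => hterm x₀ y)
          (mem_univ x₀)
    _ ≤ ∑ x, ∑ y, min (p x * q y) (p y * q x) :=
        single_le_sum (f := fun x => ∑ y, min (p x * q y) (p y * q x))
          (fun x _ => sum_nonneg fun y _ => hterm x y) (mem_univ x₀)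

/-- **`acc · (1/ESS) ≥ 8/9`** for every normalised pair (`p ≥ 0`, `q > 0`; `1/ESS = E_q w²`).
Case `Γ ≤ 1/3` (`acc ≥ 2/3`): the Gini bound `1/ESS ≥ 1 + 3Γ²` and
`(1 − Γ)(1 + 3Γ²) = 8/9 + (1 − 3Γ)³/9`.  Case `Γ > 1/3`: Cauchy–Schwarz against the rank hinge
`(m − v)₊`, `v = (3Γ − 1)/2`, whose `q`-second moment is at most `(1 − v)³/3 = (9/8)·acc³`
(`sum_midrank_hinge_sq_le`) and whose `q·w`-moment is at least `Σ q w (m − v) = acc`. [folklore] -/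
theorem accRate_mul_inv_essFrac_ge {p q : X → ℝ} (hp : ∀ x, 0 ≤ p x) (hq : ∀ x, 0 < q x)
    (hp1 : ∑ x, p x = 1) (hq1 : ∑ x, q x = 1) :
    8 / 9 ≤ accRate p q * (essFrac p q)⁻¹ := by
  classical
  set g : X → ℝ := fun x => ∑ y, q y * Real.sign (weight p q x - weight p q y) with hg
  set Γ : ℝ := ∑ x, q x * weight p q x * g x with hΓ
  set B : ℝ := (essFrac p q)⁻¹ with hBdef
  have hB : ∑ x, q x * weight p q x ^ 2 = B := sum_mul_weight_sq_eq_inv_essFrac hq hp1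
  have hΔ : ∑ x, ∑ y, q x * q y * |weight p q x - weight p q y| = 2 * Γ :=
    qq_abs_sub_eq_two_sum_midrank q (weight p q)
  have hacc : accRate p q = 1 - Γ := by
    have h1 := one_sub_accRate_eq_half_qq_abs_weight hq hp1 hq1
    rw [hΔ] at h1
    linarith
  have hacc_pos : 0 < accRate p q := accRate_pos_of_normalised hp hq hp1
  have hΓ1 : Γ < 1 := by linarith
  rcases le_or_gt Γ (1 / 3) with hcase | hcase
  · -- Case `Γ ≤ 1/3`: the Gini bound `(2Γ)² ≤ (4/3)(B − 1)`
    have hG := sq_qq_abs_weight_le_sharp hq hp1 hq1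
    rw [hΔ] at hG
    have hB1 : 1 + 3 * Γ ^ 2 ≤ B := by nlinarith
    have hmul : (1 - Γ) * (1 + 3 * Γ ^ 2) ≤ (1 - Γ) * B :=
      mul_le_mul_of_nonneg_left hB1 (by linarith)
    have hid : (1 - Γ) * (1 + 3 * Γ ^ 2) = 8 / 9 + (1 - 3 * Γ) ^ 3 / 9 := by ring
    have hcube : 0 ≤ (1 - 3 * Γ) ^ 3 := pow_nonneg (by linarith) 3
    rw [hacc]
    linarith
  · -- Case `Γ > 1/3`: Cauchy–Schwarz against the rank hinge
    set m : X → ℝ := fun x => ∑ y, q y * ((Real.sign (weight p q x - weight p q y) + 1) / 2) with hm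
    set v : ℝ := (3 * Γ - 1) / 2 with hv
    have hv0 : 0 ≤ v := by rw [hv]; linarith
    have h1v : 1 - v = 3 / 2 * (1 - Γ) := by rw [hv]; ring
    set h : X → ℝ := fun x => max (m x - v) 0 with hh
    -- the rank hinge has second moment `≤ (1 − v)³/3`
    have hT : ∑ x, q x * h x ^ 2 ≤ (1 - v) ^ 3 / 3 := by
      have ht := sum_midrank_hinge_sq_le q (weight p q) (fun x => (hq x).le) hv0 (univ : Finset X)
      rw [hq1, max_eq_left (by linarith : (0:ℝ) ≤ 1 - v)] at ht
      exact ht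
    -- its `q·w`-moment is at least `acc`
    have hD : ∑ x, q x * weight p q x * m x = (1 + Γ) / 2 := sum_mul_weight_midrank01 hq hp1 hq1
    have hP : accRate p q ≤ ∑ x, q x * weight p q x * h x := by
      have hw : ∀ x, 0 ≤ q x * weight p q x := fun x =>
        mul_nonneg (hq x).le (div_nonneg (hp x) (hq x).le)
      calc accRate p q = ∑ x, q x * weight p q x * (m x - v) := by
            have e : ∀ x, q x * weight p q x * (m x - v)
                = q x * weight p q x * m x - v * (q x * weight p q x) := fun x => by ring
            simp_rw [e]
            rw [sum_sub_distrib, ← mul_sum, hD, sum_mul_weight hq hp1, hacc, hv]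
            ring
        _ ≤ ∑ x, q x * weight p q x * h x :=
            sum_le_sum fun x _ => mul_le_mul_of_nonneg_left (le_max_left _ _) (hw x)
    -- Cauchy–Schwarz with weights `q`
    have hCS : (∑ x, q x * weight p q x * h x) ^ 2
        ≤ (∑ x, q x * weight p q x ^ 2) * ∑ x, q x * h x ^ 2 := by
      have hcs := Finset.sum_mul_sq_le_sq_mul_sq (Finset.univ : Finset X)
        (fun x => Real.sqrt (q x) * weight p q x) (fun x => Real.sqrt (q x) * h x)
      have e1 : ∀ x, Real.sqrt (q x) * weight p q x * (Real.sqrt (q x) * h x)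
          = q x * weight p q x * h x := fun x => by
        have hs : Real.sqrt (q x) * Real.sqrt (q x) = q x := Real.mul_self_sqrt (hq x).le
        calc Real.sqrt (q x) * weight p q x * (Real.sqrt (q x) * h x)
            = Real.sqrt (q x) * Real.sqrt (q x) * weight p q x * h x := by ring
          _ = q x * weight p q x * h x := by rw [hs]
      have e2 : ∀ x, (Real.sqrt (q x) * weight p q x) ^ 2 = q x * weight p q x ^ 2 :=
        fun x => by rw [mul_pow, Real.sq_sqrt (hq x).le]
      have e3 : ∀ x, (Real.sqrt (q x) * h x) ^ 2 = q x * h x ^ 2 :=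
        fun x => by rw [mul_pow, Real.sq_sqrt (hq x).le]
      simp_rw [e1, e2, e3] at hcs
      exact hcs
    rw [hB] at hCS
    -- assemble: `acc² ≤ B·(1 − v)³/3 = (9/8)·B·acc³`
    have hBpos : 0 < B := by rw [hBdef]; exact inv_pos.mpr (essFrac_pos hq hp1)
    have hacc2 : accRate p q ^ 2 ≤ B * ((1 - v) ^ 3 / 3) := by
      calc accRate p q ^ 2 ≤ (∑ x, q x * weight p q x * h x) ^ 2 :=
            pow_le_pow_left₀ hacc_pos.le hP 2
        _ ≤ B * ∑ x, q x * h x ^ 2 := hCS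
        _ ≤ B * ((1 - v) ^ 3 / 3) := mul_le_mul_of_nonneg_left hT hBpos.le
    rw [h1v, ← hacc] at hacc2
    -- `acc² ≤ (9/8)·B·acc³` with `acc > 0`
    have hkey : accRate p q ^ 2 * 1 ≤ accRate p q ^ 2 * (9 / 8 * (accRate p q * B)) := by
      nlinarith
    have h98 := le_of_mul_le_mul_left hkey (pow_pos hacc_pos 2)
    linarith

/-- **`acc ≥ (8/9)·ESS`** — the sharp linear ESS floor of the equilibrium acceptance of an
independence sampler, for every finite normalised pair (`p ≥ 0`, `q > 0`); the tree's previous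
constant was `1/2` (`essFrac_half_le_accRate`, row 2's `meanAccept_ge_half_ESS`).  Population
`ESS/N = 0.9` forces `acc ≥ 0.8`; `0.5` forces `acc ≥ 4/9`. [folklore] -/
theorem eight_ninths_essFrac_le_accRate {p q : X → ℝ} (hp : ∀ x, 0 ≤ p x) (hq : ∀ x, 0 < q x)
    (hp1 : ∑ x, p x = 1) (hq1 : ∑ x, q x = 1) :
    8 / 9 * essFrac p q ≤ accRate p q := by
  have hE : 0 < essFrac p q := essFrac_pos hq hp1
  have h := accRate_mul_inv_essFrac_ge hp hq hp1 hq1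
  have h2 := mul_le_mul_of_nonneg_right h hE.le
  rwa [mul_assoc, inv_mul_cancel₀ hE.ne', mul_one] at h2


end Summit.Ventures.LatticeQCDFlow.Theory2
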